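import Literature.Geometry.Kaehler.ComplexTorusGradedPoincarePairing
import Literature.Geometry.Kaehler.ComplexTorusLefschetzHodgeInvolutionsRational
import Literature.Geometry.Kaehler.ComplexTorusHodgeClassesDimension
import Literature.Geometry.Kaehler.ComplexTorusNeronSeveriLieAlgebraRatGrading
import HarnessLib

/-!
# `End H•(X; ℚ)` and the `ℚ`-valued graded cup-product pairing of a complex torus: André's "sous-algèbres `ℚ[L, ᶜΛ]` de `End H*(X)`" over `ℚ`

Layer `Literature/Geometry/Kaehler`, namespace `Literature.Geometry.Kaehler.ComplexTorus`; lane `lit-hodgefound` (Track 2 foundations library),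
prover seat `lit-hodgefound-p35` (generation 51, row g51-#4; sequel of row g51-#1 `ComplexTorusGradedPoincarePairing`). TWO DEFINITIONS WITH BODIES
(`rationalEndRestrict`, `poincarePairingGRat`) + proved theorems; no named fact, no instance, no notation (D-0026 net debt `0`).

WHY. André's Prop. 1.2 is a statement about subalgebras of `End H*(X)` for the RATIONAL cohomology `H*(X) = H*(X, ℚ)` and the bilinear form `∫ x ∪ *y`
on it. The tree models `H•(X; ℚ)` as the `ℚ`-subspace `rationalFormsG Φ ⊂ H•(X; ℂ) = GForm E ℂ` and the rational operators as the `ℚ`-subalgebra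
`rationalEnd Φ ⊂ End_ℂ H•(X; ℂ)` of operators preserving it (`ComplexTorusNeronSeveriLieAlgebraDefinedOverQ`); `L_η`, `H`, `Λ_η`, `w`, `*_L`, `∗`
are proved members for `η ∈ NS(X)`. This file supplies the two missing bridges: the RESTRICTION HOMOMORPHISM `rationalEnd Φ →ₐ[ℚ] End_ℚ H•(X; ℚ)`
(injective: a rational operator is determined by its action on rational classes, which span `H•(X; ℂ)` over `ℂ`), and the `ℚ`-VALUED graded cup-product
pairing on `H•(X; ℚ)` (the restriction of row g51-#1's `B_e = poincarePairingG Φ e`, which is `ℚ`-valued there by `poincarePairingG_mem_range_rat`),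
together with the transfer of adjointness from `B_e` to `B_ℚ` — so that André's list and the transposition-stability of `ℚ[L_η, Λ_η]` hold INSIDE
`End H•(X; ℚ)`, as printed.

## Sources, VERBATIM

* Y. André, *Pour une théorie inconditionnelle des motifs*, Publ. Math. IHÉS 83 (1996) [Andre1996Motifs] (held `paper:doi-10-1007-bf02698643`), §1.1
  (p. 11 = p0008 L12–L14): "`L`, `*_L`, `*_H` et `ᶜΛ` sont auto-adjoints relativement à l'accouplement de dualité de Poincaré `(x, y) ↦ ∫ x ∪ y`";
  Prop. 1.2 (p. 11 = p0008 L62–L66): "Les sous-algèbres `ℚ[L, *_L]`, `ℚ[L, *_H]`, `ℚ[L, *_L L *_L]`, `ℚ[L, ᶜΛ]` de `End H*(X)` sont égales et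
  contiennent les projecteurs de Künneth. […] la transposition relative à la forme bilinéaire `(x, y) ↦ ∫ x ∪ * y` […]".
* E. Looijenga, V. Lunts, *A Lie algebra attached to a projective variety*, Invent. Math. 129 (1997) [LooijengaLunts1997], §1 (1.7) ("`M` … defined over
  `ℚ`"; "the corresponding Lie algebra of `K`-points"), (1.3) p. 5.
* H. Lange, *Abelian Varieties over the Complex Numbers* (2023) [Lange2023AbelianVarietiesComplex], §1.1.3 Cor. 1.1.19 (`Alt(Λ, ℤ) ⊗ ℂ = Alt_ℝ(V, ℂ)`),
  §6.2.4 (p. 310: the cup-product pairing on `H•(X, ℚ)`).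

## Contents

* §1 `span_complex_rationalFormsG_eq_top` (`H•(X; ℚ) ⊗ ℂ = H•(X; ℂ)`), **`rationalEndRestrict Φ : rationalEnd Φ →ₐ[ℚ] Module.End ℚ (rationalFormsG Φ)`**
  (`T ↦ T|_{H•(X; ℚ)}`), `coe_rationalEndRestrict_apply`, **`rationalEndRestrict_injective`**.
* §2 **`poincarePairingGRat Φ e : LinearMap.BilinForm ℚ (rationalFormsG Φ)`**, `coe_poincarePairingGRat` (`(B_ℚ w w' : ℂ) = B_e w w'`),
  **`poincarePairingGRat_nondegenerate`** (Poincaré duality over `ℚ`, all degrees at once), `poincarePairingGRat_apply_of_comm` (graded symmetry),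
  **`isAdjointPair_poincarePairingGRat_of_isAdjointPair`** / **`_iff`** (adjointness for `B_ℚ` on `H•(X; ℚ)` ⟺ adjointness for `B_e` on `H•(X; ℂ)`).
* §3 ANDRÉ'S LIST IN `End H•(X; ℚ)` (`η ∈ NS(X)` non-degenerate): `isSkewAdjoint_poincarePairingGRat_countingG`, `IsNSForm.isSelfAdjoint_poincarePairingGRat_lefschetzG`
  / `_lefschetzDualG` / `_lefschetzInvolution` / `_hodgeInvolution` / `_weylOperator`, **`IsNSForm.exists_mem_adjoin_isAdjointPair_poincarePairingGRat`**
  (`ℚ[L_η, Λ_η] ⊂ End H•(X; ℚ)` is stable under `B_ℚ`-transposition), `IsNSForm.map_rationalEndRestrict_adjoin_pair` (`ℚ[L_η|, Λ_η|]` is the image of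
  `ℚ[L_η, Λ_η] ⊂ rationalEnd Φ`), Kleiman's `ℚ`-form `B_ℚ.compl₂ (*_L|)`: `coe_poincarePairingGRat_compl₂_lefschetzInvolution`,
  **`IsNSForm.poincarePairingGRat_compl₂_lefschetzInvolution_nondegenerate`**.

## Scope / not here

`*_L ∈ ℚ[L_η, Λ_η]` as a statement about the `ℚ`-ALGEBRA generated inside `End H•(X; ℚ)` (André's "sont égales") needs the abstract Jacobson–Morozov
bookkeeping over a `ℚ`-form and is left to the abstract layer (the tree has it over the base field `ℂ`: p34's `lefschetzInvolution_mem_adjoin_pair_dual`).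
-/

noncomputable section

-- `Module ℂ` / `SMulZeroClass ℂ` synthesis on `E [⋀^Fin k]→L[ℝ] ℂ` (as in `ComplexTorusLefschetzDecomposition`)
set_option maxSynthPendingDepth 3

namespace Literature.Geometry.Kaehler

namespace ComplexTorus

open Module Function Finset
open Literature.LinearAlgebra.Alternating Literature.Algebra.Lie

universe uE

variable {ι : Type*} [Fintype ι] [DecidableEq ι] {E : Type uE} [NormedAddCommGroup E] [NormedSpace ℂ E] [FiniteDimensional ℂ E]
  [Nontrivial E] (Φ : (ι → ℝ) ≃L[ℝ] E) {η : E [⋀^Fin 2]→L[ℝ] ℝ} {N : ℕ}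

/-! ## §1 `H•(X; ℚ) ⊗ ℂ = H•(X; ℂ)` and the restriction homomorphism `rationalEnd Φ → End H•(X; ℚ)` -/

section Restrict

omit [DecidableEq ι] [Nontrivial E] in
/-- **`H•(X; ℚ) ⊗_ℚ ℂ = H•(X; ℂ)`**: the complex span of the rational graded classes is all of `H•(X; ℂ) = GForm E ℂ` (degreewise
`span_complex_rationalForms_eq_top`, and every graded form is the finite sum of its homogeneous components). [cite: Lange2023AbelianVarietiesComplex, §1.1.3 Cor. 1.1.19]
[cite: LooijengaLunts1997, §1 (1.7)] -/
theorem span_complex_rationalFormsG_eq_top : Submodule.span ℂ (rationalFormsG Φ : Set (GForm E ℂ)) = ⊤ := by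
  refine eq_top_iff.2 fun w _ ↦ ?_
  rw [← sum_range_of_eq w]
  refine Submodule.sum_mem _ fun m _ ↦ ?_
  -- `of m (w m)` lies in the image of `span ℂ (rationalForms Φ m) = ⊤` under the `ℂ`-linear inclusion `of m = LinearMap.single ℂ _ m`
  have h1 : (LinearMap.single ℂ (fun k ↦ E [⋀^Fin k]→L[ℝ] ℂ) m) (w m) ∈
      (Submodule.span ℂ (rationalForms Φ m : Set (E [⋀^Fin m]→L[ℝ] ℂ))).map (LinearMap.single ℂ (fun k ↦ E [⋀^Fin k]→L[ℝ] ℂ) m) :=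
    Submodule.mem_map_of_mem (by rw [span_complex_rationalForms_eq_top Φ m]; exact Submodule.mem_top)
  rw [Submodule.map_span] at h1
  refine Submodule.span_mono ?_ h1
  rintro _ ⟨γ, hγ, rfl⟩
  exact of_mem_rationalFormsG Φ hγ

omit [Fintype ι] [DecidableEq ι] [FiniteDimensional ℂ E] [Nontrivial E] in
/-- **THE RESTRICTION HOMOMORPHISM `rationalEnd Φ →ₐ[ℚ] End H•(X; ℚ)`, `T ↦ T|_{H•(X; ℚ)}`**: a `ℂ`-linear operator on `H•(X; ℂ)` preserving the rational
classes restricts to a `ℚ`-linear operator on `H•(X; ℚ) = rationalFormsG Φ`; restriction is a homomorphism of `ℚ`-algebras (LL: "the corresponding Lie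
algebra of `K`-points"; André's "`End H*(X)`" for rational cohomology). [cite: LooijengaLunts1997, §1 (1.7), (1.9)] [cite: Andre1996Motifs, Prop. 1.2 (p. 11)] -/
def rationalEndRestrict : rationalEnd Φ →ₐ[ℚ] Module.End ℚ (rationalFormsG Φ) where
  toFun T := ((T : Module.End ℂ (GForm E ℂ)).restrictScalars ℚ).restrict fun w hw ↦ T.2 w hw
  map_one' := rfl
  map_mul' _ _ := rfl
  map_zero' := rfl
  map_add' _ _ := rfl
  commutes' q := by
    refine LinearMap.ext fun w ↦ Subtype.ext ?_
    rw [LinearMap.restrict_apply, Module.algebraMap_end_apply, Submodule.coe_smul]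
    change ((algebraMap ℚ (Module.End ℂ (GForm E ℂ)) q) : Module.End ℂ (GForm E ℂ)) (w : GForm E ℂ) = q • (w : GForm E ℂ)
    rw [Module.algebraMap_end_apply]

omit [Fintype ι] [DecidableEq ι] [FiniteDimensional ℂ E] [Nontrivial E] in
/-- Unfolding: `(T|_{H•(X; ℚ)} w : H•(X; ℂ)) = T w`. [cite: LooijengaLunts1997, §1 (1.7)] -/
@[simp] theorem coe_rationalEndRestrict_apply (T : rationalEnd Φ) (w : rationalFormsG Φ) :
    ((rationalEndRestrict Φ T w : rationalFormsG Φ) : GForm E ℂ) = (T : Module.End ℂ (GForm E ℂ)) w := rfl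

omit [DecidableEq ι] [Nontrivial E] in
/-- **`rationalEnd Φ → End H•(X; ℚ)` IS INJECTIVE**: a rational operator is determined by its restriction to the rational classes (they span `H•(X; ℂ)` over
`ℂ`). [cite: LooijengaLunts1997, §1 (1.7)] [cite: Lange2023AbelianVarietiesComplex, §1.1.3 Cor. 1.1.19] -/
theorem rationalEndRestrict_injective : Function.Injective (rationalEndRestrict Φ) := by
  intro S T hST
  apply Subtype.ext
  refine LinearMap.ext_on (span_complex_rationalFormsG_eq_top Φ) fun w hw ↦ ?_
  have h1 := congrArg (fun f ↦ ((f ⟨w, hw⟩ : rationalFormsG Φ) : GForm E ℂ)) hST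
  simpa only [coe_rationalEndRestrict_apply] using h1

end Restrict

/-! ## §2 The `ℚ`-valued graded cup-product pairing on `H•(X; ℚ)` -/

section RatPairing

omit [Fintype ι] [FiniteDimensional ℂ E] [Nontrivial E] in
/-- **The `ℚ`-valued graded cup-product (Poincaré) pairing `B_ℚ` on `H•(X; ℚ) = rationalFormsG Φ`**: the restriction of the graded pairing
`B_e = poincarePairingG Φ e` of `H•(X; ℂ)` (row g51-#1) to the rational classes, where it takes rational values (`poincarePairingG_mem_range_rat`), as a
`ℚ`-bilinear form (Mathlib's `LinearMap.restrictScalarsRange₂`, exactly as the degreewise `poincarePairingRat`). [cite: Andre1996Motifs, §1.1 (p. 11) and Prop. 1.2 (p. 11)]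
[cite: Lange2023AbelianVarietiesComplex, §6.2.4 (p. 310)] -/
def poincarePairingGRat (e : Fin N ≃ ι) : LinearMap.BilinForm ℚ (rationalFormsG Φ) :=
  LinearMap.restrictScalarsRange₂ (rationalFormsG Φ).subtype (rationalFormsG Φ).subtype (Algebra.linearMap ℚ ℂ) (algebraMap ℚ ℂ).injective
    (poincarePairingG Φ e) fun w w' ↦ by
      obtain ⟨q, hq⟩ := poincarePairingG_mem_range_rat Φ e w.2 w'.2
      exact ⟨q, by rw [Algebra.linearMap_apply, eq_ratCast, ← hq, Submodule.subtype_apply, Submodule.subtype_apply]⟩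

omit [Fintype ι] [FiniteDimensional ℂ E] [Nontrivial E] in
/-- **`(B_ℚ(w, w') : ℂ) = B_e(w, w')`.** [cite: Lange2023AbelianVarietiesComplex, §6.2.4 (p. 310)] -/
@[simp] theorem coe_poincarePairingGRat (e : Fin N ≃ ι) (w w' : rationalFormsG Φ) :
    ((poincarePairingGRat Φ e w w' : ℚ) : ℂ) = poincarePairingG Φ e w w' := by
  have h1 := LinearMap.restrictScalarsRange₂_apply (rationalFormsG Φ).subtype (rationalFormsG Φ).subtype (Algebra.linearMap ℚ ℂ)
    (algebraMap ℚ ℂ).injective (poincarePairingG Φ e) (fun w w' ↦ by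
      obtain ⟨q, hq⟩ := poincarePairingG_mem_range_rat Φ e w.2 w'.2
      exact ⟨q, by rw [Algebra.linearMap_apply, eq_ratCast, ← hq, Submodule.subtype_apply, Submodule.subtype_apply]⟩) w w'
  rw [Algebra.linearMap_apply, eq_ratCast, Submodule.subtype_apply, Submodule.subtype_apply] at h1
  exact h1

omit [Nontrivial E] in
/-- **POINCARÉ DUALITY OVER `ℚ`, ALL DEGREES AT ONCE: `B_ℚ` IS NON-DEGENERATE on `H•(X; ℚ)`** (`B_e` is non-degenerate and `ℂ`-linear in each variable, and
`H•(X; ℚ)` spans `H•(X; ℂ)`). [cite: Lange2023AbelianVarietiesComplex, §6.2.4 (p. 310)] -/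
theorem poincarePairingGRat_nondegenerate (e : Fin N ≃ ι) : (poincarePairingGRat Φ e).Nondegenerate := by
  obtain ⟨hl, hr⟩ := poincarePairingG_nondegenerate Φ e
  refine ⟨fun w hw ↦ Subtype.ext (hl _ fun w' ↦ ?_), fun w' hw ↦ Subtype.ext (hr _ fun w ↦ ?_)⟩
  · -- `B_e(w, ·)` vanishes on `H•(X; ℚ)`, hence on its complex span
    have h0 : poincarePairingG Φ e (w : GForm E ℂ) = 0 := by
      refine LinearMap.ext_on (span_complex_rationalFormsG_eq_top Φ) fun w' hw' ↦ ?_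
      rw [LinearMap.zero_apply, ← coe_poincarePairingGRat Φ e w ⟨w', hw'⟩, hw, Rat.cast_zero]
    rw [h0, LinearMap.zero_apply]
  · have h0 : (poincarePairingG Φ e).flip (w' : GForm E ℂ) = 0 := by
      refine LinearMap.ext_on (span_complex_rationalFormsG_eq_top Φ) fun w hw' ↦ ?_
      change poincarePairingG Φ e w w' = (0 : GForm E ℂ →ₗ[ℂ] ℂ) w
      rw [LinearMap.zero_apply, ← coe_poincarePairingGRat Φ e ⟨w, hw'⟩ w', hw, Rat.cast_zero]
    exact LinearMap.congr_fun h0 w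

omit [Nontrivial E] in
/-- **Graded symmetry over `ℚ`: `B_ℚ(w, of k x) = (-1)ᵏ B_ℚ(of k x, w)`** for a rational homogeneous class `x` of degree `k`.
[cite: Lange2023AbelianVarietiesComplex, §1.1.3 Lemma 1.1.17 (b)] -/
theorem poincarePairingGRat_apply_of_comm (e : Fin N ≃ ι) {k : ℕ} {x : E [⋀^Fin k]→L[ℝ] ℂ} (hx : x ∈ rationalForms Φ k) (w : rationalFormsG Φ) :
    poincarePairingGRat Φ e w ⟨GForm.of k x, of_mem_rationalFormsG Φ hx⟩ =
      (-1) ^ k * poincarePairingGRat Φ e ⟨GForm.of k x, of_mem_rationalFormsG Φ hx⟩ w := by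
  apply Rat.cast_injective (α := ℂ)
  rw [coe_poincarePairingGRat, Rat.cast_mul, Rat.cast_pow, Rat.cast_neg, Rat.cast_one, coe_poincarePairingGRat]
  exact poincarePairingG_apply_of_comm Φ e x w

omit [Fintype ι] [FiniteDimensional ℂ E] [Nontrivial E] in
/-- **TRANSFER OF ADJOINTNESS TO `ℚ`**: if `T, T'` are rational operators, `B_e`-adjoint on `H•(X; ℂ)`, then their restrictions are `B_ℚ`-adjoint on `H•(X; ℚ)`.
[cite: Andre1996Motifs, §1.1 (p. 11) and Prop. 1.2 (p. 11)] [cite: LooijengaLunts1997, §1 (1.7)] -/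
theorem isAdjointPair_poincarePairingGRat_of_isAdjointPair (e : Fin N ≃ ι) {T T' : rationalEnd Φ}
    (h : LinearMap.IsAdjointPair (poincarePairingG Φ e) (poincarePairingG Φ e) (T : Module.End ℂ (GForm E ℂ)) (T' : Module.End ℂ (GForm E ℂ))) :
    LinearMap.IsAdjointPair (poincarePairingGRat Φ e) (poincarePairingGRat Φ e) (rationalEndRestrict Φ T) (rationalEndRestrict Φ T') := fun w w' ↦ by
  apply Rat.cast_injective (α := ℂ)
  rw [coe_poincarePairingGRat, coe_poincarePairingGRat, coe_rationalEndRestrict_apply, coe_rationalEndRestrict_apply]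
  exact h w w'

omit [Nontrivial E] in
/-- **… AND BACK: adjointness on the rational classes implies adjointness on `H•(X; ℂ)`** (both sides are `ℂ`-bilinear and `H•(X; ℚ)` spans): for rational
operators, `B_ℚ`-adjointness of the restrictions is EQUIVALENT to `B_e`-adjointness. [cite: LooijengaLunts1997, §1 (1.7)] [cite: Andre1996Motifs, Prop. 1.2 (p. 11)] -/
theorem isAdjointPair_poincarePairingGRat_iff (e : Fin N ≃ ι) {T T' : rationalEnd Φ} :
    LinearMap.IsAdjointPair (poincarePairingGRat Φ e) (poincarePairingGRat Φ e) (rationalEndRestrict Φ T) (rationalEndRestrict Φ T') ↔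
      LinearMap.IsAdjointPair (poincarePairingG Φ e) (poincarePairingG Φ e) (T : Module.End ℂ (GForm E ℂ)) (T' : Module.End ℂ (GForm E ℂ)) := by
  refine ⟨fun h ↦ ?_, isAdjointPair_poincarePairingGRat_of_isAdjointPair Φ e⟩
  rw [LinearMap.isAdjointPair_iff_comp_eq_compl₂]
  refine LinearMap.ext_on (span_complex_rationalFormsG_eq_top Φ) fun w hw ↦ ?_
  refine LinearMap.ext_on (span_complex_rationalFormsG_eq_top Φ) fun w' hw' ↦ ?_
  rw [LinearMap.comp_apply, LinearMap.compl₂_apply]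
  have h1 := congrArg (fun q : ℚ ↦ (q : ℂ)) (h ⟨w, hw⟩ ⟨w', hw'⟩)
  simpa only [coe_poincarePairingGRat, coe_rationalEndRestrict_apply] using h1

end RatPairing

/-! ## §3 André's list inside `End H•(X; ℚ)`; `ℚ[L_η, Λ_η]` is transposition-stable; Kleiman's `ℚ`-form -/

section AndreRat

omit [Nontrivial E] in
/-- **`H|_{H•(X; ℚ)}` is `B_ℚ`-skew-adjoint** (every complex torus). [cite: LooijengaLunts1997, §1 (1.3), (1.7)] [cite: Andre1996Motifs, §1.1 (p. 11)] -/
theorem isSkewAdjoint_poincarePairingGRat_countingG (e : Fin N ≃ ι) :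
    (poincarePairingGRat Φ e).IsSkewAdjoint (rationalEndRestrict Φ ⟨countingG E, countingG_mem_rationalEnd Φ⟩) := by
  have h1 : rationalEndRestrict Φ ⟨-countingG E, (rationalEnd Φ).neg_mem (countingG_mem_rationalEnd Φ)⟩ =
      -rationalEndRestrict Φ ⟨countingG E, countingG_mem_rationalEnd Φ⟩ := by
    rw [← map_neg]; rfl
  change LinearMap.IsAdjointPair _ _ _ ⇑(-rationalEndRestrict Φ ⟨countingG E, countingG_mem_rationalEnd Φ⟩)
  rw [← h1]
  exact isAdjointPair_poincarePairingGRat_of_isAdjointPair Φ e (isSkewAdjoint_poincarePairingG_countingG Φ e)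

omit [Fintype ι] [Nontrivial E] in
/-- **"`L` […] auto-adjoint" IN `End H•(X; ℚ)`: `L_η|_{H•(X; ℚ)}` is `B_ℚ`-self-adjoint** for every `η ∈ NS(X)`. [cite: Andre1996Motifs, §1.1 (p. 11) and Prop. 1.2 (p. 11)] -/
theorem IsNSForm.isSelfAdjoint_poincarePairingGRat_lefschetzG (hNS : IsNSForm Φ η) (e : Fin N ≃ ι) :
    (poincarePairingGRat Φ e).IsSelfAdjoint
      (rationalEndRestrict Φ ⟨lefschetzG η, lefschetzG_mem_rationalEnd Φ (hNS.ofRealForm_mem_rationalForms Φ)⟩) :=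
  isAdjointPair_poincarePairingGRat_of_isAdjointPair Φ e (isSelfAdjoint_poincarePairingG_lefschetzG Φ η e)

/-- **"`ᶜΛ` […] auto-adjoint" IN `End H•(X; ℚ)`: `Λ_η|_{H•(X; ℚ)}` is `B_ℚ`-self-adjoint** for every non-degenerate `η ∈ NS(X)`.
[cite: Andre1996Motifs, §1.1 (p. 11) and Prop. 1.2 (p. 11)] -/
theorem IsNSForm.isSelfAdjoint_poincarePairingGRat_lefschetzDualG (hNS : IsNSForm Φ η) (hη : ∀ v : E, v ≠ 0 → ∃ w : E, η ![v, w] ≠ 0) (e : Fin N ≃ ι) :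
    (poincarePairingGRat Φ e).IsSelfAdjoint
      (rationalEndRestrict Φ ⟨lefschetzDualG η, lefschetzDualG_mem_rationalEnd Φ (mem_neronSeveriQ_of_isNSForm Φ hNS) hη⟩) :=
  isAdjointPair_poincarePairingGRat_of_isAdjointPair Φ e (isSelfAdjoint_poincarePairingG_lefschetzDualG Φ hη e)

/-- **"`*_L` […] auto-adjoint" IN `End H•(X; ℚ)`: `*_L|_{H•(X; ℚ)}` is `B_ℚ`-self-adjoint** (`η ∈ NS(X)` non-degenerate; `*_L` is rational by row g50-#6).
[cite: Andre1996Motifs, §1.1 (p. 11) and Prop. 1.2 (p. 11)] -/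
theorem IsNSForm.isSelfAdjoint_poincarePairingGRat_lefschetzInvolution (hNS : IsNSForm Φ η) (hη : ∀ v : E, v ≠ 0 → ∃ w : E, η ![v, w] ≠ 0)
    (e : Fin N ≃ ι) :
    (poincarePairingGRat Φ e).IsSelfAdjoint (rationalEndRestrict Φ
      ⟨(hasLefschetzProperty_lefschetzG hη).lefschetzInvolution isZGrading_countingG, hNS.lefschetzInvolution_mem_rationalEnd Φ hη⟩) :=
  isAdjointPair_poincarePairingGRat_of_isAdjointPair Φ e (isSelfAdjoint_poincarePairingG_lefschetzInvolution Φ hη e)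

/-- **Kleiman–Milne's `∗|_{H•(X; ℚ)}` is `B_ℚ`-self-adjoint** (`d = g`, `η ∈ NS(X)` non-degenerate). [cite: Milne1999LefschetzClasses, §5 p. 664–665]
[cite: Andre1996Motifs, Prop. 1.2 (p. 11)] -/
theorem IsNSForm.isSelfAdjoint_poincarePairingGRat_hodgeInvolution (hNS : IsNSForm Φ η) (hη : ∀ v : E, v ≠ 0 → ∃ w : E, η ![v, w] ≠ 0) (e : Fin N ≃ ι) :
    (poincarePairingGRat Φ e).IsSelfAdjoint (rationalEndRestrict Φ
      ⟨(hasLefschetzProperty_lefschetzG hη).hodgeInvolution isZGrading_countingG (finrank ℂ E), hNS.hodgeInvolution_mem_rationalEnd Φ hη⟩) :=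
  isAdjointPair_poincarePairingGRat_of_isAdjointPair Φ e (isSelfAdjoint_poincarePairingG_hodgeInvolution Φ hη e (finrank ℂ E))

/-- **The Weyl operator `w|_{H•(X; ℚ)}` is `B_ℚ`-self-adjoint** (`η ∈ NS(X)` non-degenerate; `w` is rational by row g47-#3).
[cite: Andre1996Motifs, §1.1–§1.2 (p. 11)] [cite: LooijengaLunts1997, §1 (1.3), (1.7)] -/
theorem IsNSForm.isSelfAdjoint_poincarePairingGRat_weylOperator (hNS : IsNSForm Φ η) (hη : ∀ v : E, v ≠ 0 → ∃ w : E, η ![v, w] ≠ 0) (e : Fin N ≃ ι) :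
    (poincarePairingGRat Φ e).IsSelfAdjoint (rationalEndRestrict Φ
      ⟨(hasLefschetzProperty_lefschetzG hη).weylOperator isZGrading_countingG, weylOperator_mem_rationalEnd Φ (mem_neronSeveriQ_of_isNSForm Φ hNS) hη⟩) :=
  isAdjointPair_poincarePairingGRat_of_isAdjointPair Φ e (isSelfAdjoint_poincarePairingG_weylOperator Φ hη e)

/-- **ANDRÉ'S `ℚ[L, ᶜΛ] ⊂ End H*(X)` IS STABLE UNDER TRANSPOSITION for `∫ x ∪ y`**: every element of the `ℚ`-subalgebra of `End H•(X; ℚ)` generated by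
`L_η|` and `Λ_η|` has a `B_ℚ`-adjoint in that subalgebra (`η ∈ NS(X)` non-degenerate; p34's generic `exists_isAdjointPair_of_mem_adjoin` over `K = ℚ`).
[cite: Andre1996Motifs, §1.1 (p. 11) and Prop. 1.2 (pp. 11–12)] -/
theorem IsNSForm.exists_mem_adjoin_isAdjointPair_poincarePairingGRat (hNS : IsNSForm Φ η) (hη : ∀ v : E, v ≠ 0 → ∃ w : E, η ![v, w] ≠ 0) (e : Fin N ≃ ι)
    {T : Module.End ℚ (rationalFormsG Φ)}
    (hT : T ∈ Algebra.adjoin ℚ ({rationalEndRestrict Φ ⟨lefschetzG η, lefschetzG_mem_rationalEnd Φ (hNS.ofRealForm_mem_rationalForms Φ)⟩,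
      rationalEndRestrict Φ ⟨lefschetzDualG η, lefschetzDualG_mem_rationalEnd Φ (mem_neronSeveriQ_of_isNSForm Φ hNS) hη⟩} :
        Set (Module.End ℚ (rationalFormsG Φ)))) :
    ∃ T' ∈ Algebra.adjoin ℚ ({rationalEndRestrict Φ ⟨lefschetzG η, lefschetzG_mem_rationalEnd Φ (hNS.ofRealForm_mem_rationalForms Φ)⟩,
      rationalEndRestrict Φ ⟨lefschetzDualG η, lefschetzDualG_mem_rationalEnd Φ (mem_neronSeveriQ_of_isNSForm Φ hNS) hη⟩} :
        Set (Module.End ℚ (rationalFormsG Φ))), LinearMap.IsAdjointPair (poincarePairingGRat Φ e) (poincarePairingGRat Φ e) T T' := by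
  refine exists_isAdjointPair_of_mem_adjoin ?_ hT
  rintro a (rfl | rfl)
  · exact hNS.isSelfAdjoint_poincarePairingGRat_lefschetzG Φ e
  · exact hNS.isSelfAdjoint_poincarePairingGRat_lefschetzDualG Φ hη e

/-- **`ℚ[L_η, Λ_η] ⊂ End H•(X; ℚ)` is the image of the rational operators in `ℂ[L_η, Λ_η]`**: the restriction homomorphism maps the `ℚ`-subalgebra
generated by `L_η`, `Λ_η` inside `rationalEnd Φ` ONTO `ℚ[L_η|, Λ_η|]` (`AlgHom.map_adjoin`). [cite: Andre1996Motifs, Prop. 1.2 (p. 11)] [cite: LooijengaLunts1997, §1 (1.7)] -/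
theorem IsNSForm.map_rationalEndRestrict_adjoin_pair (hNS : IsNSForm Φ η) (hη : ∀ v : E, v ≠ 0 → ∃ w : E, η ![v, w] ≠ 0) :
    (Algebra.adjoin ℚ ({⟨lefschetzG η, lefschetzG_mem_rationalEnd Φ (hNS.ofRealForm_mem_rationalForms Φ)⟩,
        ⟨lefschetzDualG η, lefschetzDualG_mem_rationalEnd Φ (mem_neronSeveriQ_of_isNSForm Φ hNS) hη⟩} : Set (rationalEnd Φ))).map
      (rationalEndRestrict Φ) =
      Algebra.adjoin ℚ ({rationalEndRestrict Φ ⟨lefschetzG η, lefschetzG_mem_rationalEnd Φ (hNS.ofRealForm_mem_rationalForms Φ)⟩,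
        rationalEndRestrict Φ ⟨lefschetzDualG η, lefschetzDualG_mem_rationalEnd Φ (mem_neronSeveriQ_of_isNSForm Φ hNS) hη⟩} :
          Set (Module.End ℚ (rationalFormsG Φ))) := by
  rw [AlgHom.map_adjoin, Set.image_pair]

/-- **Kleiman's `ℚ`-form `B_ℚ(w, *_L| w')` evaluates to `K_L`**: `((B_ℚ.compl₂ *_L|) w w' : ℂ) = B_e(w, *_L w')`. [cite: Andre1996Motifs, Prop. 1.2 (p. 11)] -/
theorem coe_poincarePairingGRat_compl₂_lefschetzInvolution (hNS : IsNSForm Φ η) (hη : ∀ v : E, v ≠ 0 → ∃ w : E, η ![v, w] ≠ 0) (e : Fin N ≃ ι)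
    (w w' : rationalFormsG Φ) :
    (((poincarePairingGRat Φ e).compl₂ (rationalEndRestrict Φ
        ⟨(hasLefschetzProperty_lefschetzG hη).lefschetzInvolution isZGrading_countingG, hNS.lefschetzInvolution_mem_rationalEnd Φ hη⟩) w w' : ℚ) : ℂ) =
      (poincarePairingG Φ e).compl₂ ((hasLefschetzProperty_lefschetzG hη).lefschetzInvolution isZGrading_countingG) (w : GForm E ℂ) (w' : GForm E ℂ) := by
  rw [LinearMap.compl₂_apply, LinearMap.compl₂_apply, coe_poincarePairingGRat, coe_rationalEndRestrict_apply]

/-- **KLEIMAN'S `ℚ`-FORM `(x, y) ↦ ∫ x ∪ *_L y` ON `H•(X; ℚ)` IS NON-DEGENERATE** (`η ∈ NS(X)` non-degenerate): `B_ℚ` is non-degenerate and `*_L|` is an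
involution of `H•(X; ℚ)`. [cite: Andre1996Motifs, Prop. 1.2 (p. 11)] [cite: Lange2023AbelianVarietiesComplex, §6.2.4 (p. 310)] -/
theorem IsNSForm.poincarePairingGRat_compl₂_lefschetzInvolution_nondegenerate (hNS : IsNSForm Φ η) (hη : ∀ v : E, v ≠ 0 → ∃ w : E, η ![v, w] ≠ 0)
    (e : Fin N ≃ ι) :
    ((poincarePairingGRat Φ e).compl₂ (rationalEndRestrict Φ
        ⟨(hasLefschetzProperty_lefschetzG hη).lefschetzInvolution isZGrading_countingG, hNS.lefschetzInvolution_mem_rationalEnd Φ hη⟩)).Nondegenerate := by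
  set s := rationalEndRestrict Φ
    ⟨(hasLefschetzProperty_lefschetzG hη).lefschetzInvolution isZGrading_countingG, hNS.lefschetzInvolution_mem_rationalEnd Φ hη⟩ with hs
  have hss : ∀ w, s (s w) = w := fun w ↦ Subtype.ext (by
    rw [hs, coe_rationalEndRestrict_apply, coe_rationalEndRestrict_apply]
    exact (hasLefschetzProperty_lefschetzG hη).lefschetzInvolution_lefschetzInvolution isZGrading_countingG _)
  obtain ⟨hl, hr⟩ := poincarePairingGRat_nondegenerate Φ e
  refine ⟨fun w hw ↦ hl w fun w' ↦ ?_, fun w' hw ↦ ?_⟩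
  · have h1 := hw (s w')
    rwa [LinearMap.compl₂_apply, hss] at h1
  · have h1 : s w' = 0 := hr _ fun w ↦ by
      have h2 := hw w
      rwa [LinearMap.compl₂_apply] at h2
    rw [← hss w', h1, map_zero]

end AndreRat

end ComplexTorus

end Literature.Geometry.Kaehler

end
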